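import Summits.MatrixMultiplication.MatrixMultiplication.Theorems.ObstructionDescentUniversalOccurrenceTripods
import Summits.MatrixMultiplication.MatrixMultiplication.Theorems.ObstructionCalculusSchurWeylConverse
import Summits.MatrixMultiplication.MatrixMultiplication.Theorems.ObstructionDescentSubformatObstruction
import Literature.Computability.AlgebraicComplexity.StrassenCommutatorLowerBound
import Literature.NumberTheory.DiophantineGeometry.KroneckerSemigroup
import Literature.RepresentationTheory.FiniteGroups.SymmetricGroupCharacterEvaluation

set_option linter.dupNamespace false
set_option autoImplicit false

/-!
# Universal occurrence, row `N = 3` closed: `¬UOCC(4, 3)`, hence `u(3) = 5` (route `ObstructionDescent`)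

Support file (kernel K14) for the crux `NoOccurrenceObstruction` (`P_O`, item `stmt-MatrixMultiplication-29040`) of
`Summit.MatrixMultiplication.MatrixMultiplication.Theses.ObstructionDescent`; sequel of `ObstructionDescentUniversalOccurrenceTripods` (`uocc_five_three`,
the upper cell `UOCC(5, 3)`) and of the hook band of `ObstructionDescentUniversalOccurrence` (which at `N = 3` only gives `u(3) ≥ 4`).  `UOCC(m, N)` (spelled
out literally below): every partition triple occurring in a tensor power of some complex tensor on `≤ N` letters occurs in the same power of the unit tensor
`⟨m⟩`; `u(N)` is the least such `m`.  The LOWER cell of row `3` is closed by an OBSTRUCTION OF MULTIPLICITY ONE: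
* the type `λ_S = ((6,3,3),(4,4,4),(4,4,4)) ⊢ 12` has `g(λ_S) = 1` (`kroneckerCoeff_strassenType`: class sum `= 12!` by the verified Murnaghan–Nakayama
  evaluator, `decide +kernel`), and `dim HWV_Λ(ℂ[V]_d) ≤ g(λ)` in general (`finrank_hwvSpace_le_kroneckerCoeff`, NEW: the symmetric array `arrOf` embeds
  `HWV_Λ` into the `S_d`-invariants of the triple highest-weight slice, counted by `finrank_invariants_tripleHwRep`);
* Strassen's form `S(Y₀,Y₁,Y₂) = det(Y₀·adj Y₂·Y₁ − Y₁·adj Y₂·Y₀)` (`= det Y₂ ·` Strassen's degree-`9` equation of `σ₄(ℙ²×ℙ²×ℙ²)`; the degree-`12`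
  multiple is literally a determinant, so no polynomial division has to be certified), read in the lower-right `3×3×3` corner variables of `ℂ⁴⊗ℂ⁴⊗ℂ⁴`
  with the protected slice LAST, is a highest weight vector of reversed type `λ_S` (`strassenForm_mem_hwvSpace`, from the slice-mixing law
  `S(a₀₀Y₀+a₀₁Y₁+a₀₂Y₂, a₁₁Y₁+a₁₂Y₂, a₂₂Y₂) = a₀₀³a₁₁³a₂₂⁶·S` and the sandwich law `S(BY₀Cᵀ,BY₁Cᵀ,BY₂Cᵀ) = det B⁴det C⁴·S` over any commutative ring);
* `S` vanishes on `Mat₄³·⟨4⟩` (`evalT_fromCols_strassenForm`: the corner of `[A|B|C]` has rank `≤ 4`, so by `2·3 + rk(Y₀Y₂⁻¹Y₁ − Y₁Y₂⁻¹Y₀) ≤ 2R`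
  (`BCS1997_thm_19_12_rank`) the matrix is singular when `Y₂` is invertible; the singular case by density, `P·D ≡ 0`), hence `HWV_{λ_S} = ℂ·S ⊆ I(GL₄³·⟨4⟩)`:
  `λ_S` does not occur in `⟨4⟩^{⊗12}`; and `S(diag(0,1,2), P_cyc, 1) = −2 ≠ 0`, so `λ_S` occurs in `s₀^{⊗12}` for this `3×3×3` tensor `s₀` (padding bridge).
Hence `¬UOCC(4, 3)` (`not_uocc_four_three`) and, with `uocc_five_three`, **`UOCC(m, 3) ↔ 5 ≤ m`, i.e. `u(3) = 5 = R_gen(3)`** (`uocc_three_iff_five_le`) —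
the first row `N ≥ 3` whose two cells meet.  Ladder now: `u(2) ≤ 2`, `u(3) = 5`, `6 ≤ u(4) ≤ 7`, `7 ≤ u(5) ≤ 10`, `7 ≤ u(6) ≤ 14`, `10 ≤ u(7) ≤ 19`,
`3⌊(N−1)/2⌋ + 1 ≤ u(N) ≤ ⌈N²/2⌉` (`8 ≤ N ≤ 16`).  All theorems, no `def`, no `sorry`, standard axioms (`decide +kernel` only for the class sum).
References: V. Strassen, Linear Algebra Appl. 52/53 (1983) [key Strassen1983]; Bürgisser–Clausen–Shokrollahi (1997), Thm. (19.12)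
[key BurgisserClausenShokrollahi1997]; Bürgisser–Ikenmeyer, STOC 2011 / arXiv:1011.1350, §3.1, Lemma 3.2, §10.1 [key BurgisserIkenmeyer2011];
Ikenmeyer–Panova, Adv. Math. 319 (2017), §1.1 [key IkenmeyerPanova2017]; Fulton–Harris, GTM 129, Ex. 4.51 [key FultonHarrisGTM129]; T. Lickteig,
Linear Algebra Appl. 69 (1985) [key Lickteig1985].
-/

open scoped BigOperators
namespace Summit.MatrixMultiplication.MatrixMultiplication.Theorems.ObstructionCalculus

open MvPolynomial Matrix
open Literature.Computability.AlgebraicComplexity (actTensor actTensor_apply kroneckerPow isotypicSum₁ isotypicSum₂ isotypicSum₃ unitTensor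
  tensorRank triad triad_apply tensorRank_le_of_eq_sum arrOf arrOf_comp_perm sum_arrOf_mul_prod_X)
open Literature.NumberTheory.DiophantineGeometry (Word Word3 Weight tripleHw mem_tripleHw_iff tripleHwRep permute3 coe_tripleHwRep_apply
  finrank_invariants_tripleHwRep kroneckerCoeff)
open Literature.RepresentationTheory.FiniteGroups.MNEval (kronSum kroneckerCoeff_eq_kronSum_div)

/-! ## §0  Strassen's form `S(Y₀, Y₁, Y₂) = det (Y₀ · adj Y₂ · Y₁ − Y₁ · adj Y₂ · Y₀)`: three laws, and its homogeneity -/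

/-- Strassen's form commutes with ring maps (it is a polynomial in the entries). [folklore] -/
theorem strassenForm_map {R S : Type*} [CommRing R] [CommRing S] (φ : R →+* S) (Y₀ Y₁ Y₂ : Matrix (Fin 3) (Fin 3) R) :
    φ (Y₀ * Y₂.adjugate * Y₁ - Y₁ * Y₂.adjugate * Y₀).det =
      (φ.mapMatrix Y₀ * (φ.mapMatrix Y₂).adjugate * φ.mapMatrix Y₁ - φ.mapMatrix Y₁ * (φ.mapMatrix Y₂).adjugate * φ.mapMatrix Y₀).det := by
  rw [RingHom.map_det, map_sub, map_mul, map_mul, map_mul, map_mul, RingHom.map_adjugate]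

/-- **Slice-mixing law** (upper-triangular change of slices, protected slice last):
`S(a₀₀Y₀ + a₀₁Y₁ + a₀₂Y₂, a₁₁Y₁ + a₁₂Y₂, a₂₂Y₂) = a₀₀³ a₁₁³ a₂₂⁶ · S(Y₀, Y₁, Y₂)` (from `Y₂·adj Y₂ = adj Y₂·Y₂ = det Y₂·1`, `adj(aY₂) = a²adj Y₂`).
[cite: Strassen1983] [cite: BurgisserClausenShokrollahi1997, Thm. (19.12)] -/
theorem strassenForm_mix {R : Type*} [CommRing R] (Y₀ Y₁ Y₂ : Matrix (Fin 3) (Fin 3) R) (a₀₀ a₀₁ a₀₂ a₁₁ a₁₂ a₂₂ : R) :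
    ((a₀₀ • Y₀ + a₀₁ • Y₁ + a₀₂ • Y₂) * (a₂₂ • Y₂).adjugate * (a₁₁ • Y₁ + a₁₂ • Y₂) -
        (a₁₁ • Y₁ + a₁₂ • Y₂) * (a₂₂ • Y₂).adjugate * (a₀₀ • Y₀ + a₀₁ • Y₁ + a₀₂ • Y₂)).det =
      a₀₀ ^ 3 * a₁₁ ^ 3 * a₂₂ ^ 6 * (Y₀ * Y₂.adjugate * Y₁ - Y₁ * Y₂.adjugate * Y₀).det := by
  have hadj : (a₂₂ • Y₂).adjugate = a₂₂ ^ 2 • Y₂.adjugate := by rw [Matrix.adjugate_smul, Fintype.card_fin]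
  have hL : ∀ X : Matrix (Fin 3) (Fin 3) R, Y₂ * (Y₂.adjugate * X) = Y₂.det • X := fun X => by
    rw [← Matrix.mul_assoc, Matrix.mul_adjugate, Matrix.smul_mul, Matrix.one_mul]
  have hR : ∀ X : Matrix (Fin 3) (Fin 3) R, X * (Y₂.adjugate * Y₂) = Y₂.det • X := fun X => by
    rw [Matrix.adjugate_mul, Matrix.mul_smul, Matrix.mul_one]
  have key : (a₀₀ • Y₀ + a₀₁ • Y₁ + a₀₂ • Y₂) * (a₂₂ • Y₂).adjugate * (a₁₁ • Y₁ + a₁₂ • Y₂) -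
      (a₁₁ • Y₁ + a₁₂ • Y₂) * (a₂₂ • Y₂).adjugate * (a₀₀ • Y₀ + a₀₁ • Y₁ + a₀₂ • Y₂) =
      (a₂₂ ^ 2 * a₀₀ * a₁₁) • (Y₀ * Y₂.adjugate * Y₁ - Y₁ * Y₂.adjugate * Y₀) := by
    rw [hadj]; simp only [Matrix.add_mul, Matrix.mul_add, Matrix.smul_mul, Matrix.mul_smul, Matrix.mul_assoc, hL, hR, smul_sub, smul_add, smul_smul]
    module
  rw [key, Matrix.det_smul, Fintype.card_fin]; ring

/-- **Sandwich law**: `S(B Y₀ Cᵀ, B Y₁ Cᵀ, B Y₂ Cᵀ) = det B⁴ det C⁴ · S(Y₀, Y₁, Y₂)` (no invertibility needed: `adj(B Y Cᵀ) = adj Cᵀ·adj Y·adj B`).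
[cite: Strassen1983] [cite: BurgisserClausenShokrollahi1997, Thm. (19.12)] -/
theorem strassenForm_sandwich {R : Type*} [CommRing R] (B C Y₀ Y₁ Y₂ : Matrix (Fin 3) (Fin 3) R) :
    (B * Y₀ * Cᵀ * (B * Y₂ * Cᵀ).adjugate * (B * Y₁ * Cᵀ) - B * Y₁ * Cᵀ * (B * Y₂ * Cᵀ).adjugate * (B * Y₀ * Cᵀ)).det =
      B.det ^ 4 * C.det ^ 4 * (Y₀ * Y₂.adjugate * Y₁ - Y₁ * Y₂.adjugate * Y₀).det := by
  have hC : ∀ X : Matrix (Fin 3) (Fin 3) R, Cᵀ * (Cᵀ.adjugate * X) = C.det • X := fun X => by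
    rw [← Matrix.mul_assoc, Matrix.mul_adjugate, Matrix.det_transpose, Matrix.smul_mul, Matrix.one_mul]
  have hB : ∀ X : Matrix (Fin 3) (Fin 3) R, B.adjugate * (B * X) = B.det • X := fun X => by
    rw [← Matrix.mul_assoc, Matrix.adjugate_mul, Matrix.smul_mul, Matrix.one_mul]
  have key : B * Y₀ * Cᵀ * (B * Y₂ * Cᵀ).adjugate * (B * Y₁ * Cᵀ) - B * Y₁ * Cᵀ * (B * Y₂ * Cᵀ).adjugate * (B * Y₀ * Cᵀ) =
      (B.det * C.det) • (B * (Y₀ * Y₂.adjugate * Y₁ - Y₁ * Y₂.adjugate * Y₀) * Cᵀ) := by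
    simp only [Matrix.adjugate_mul_distrib, Matrix.mul_assoc, hC, hB, Matrix.mul_smul, Matrix.smul_mul, Matrix.mul_sub, Matrix.sub_mul,
      smul_sub, smul_smul]
    module
  rw [key, Matrix.det_smul, Fintype.card_fin, Matrix.det_mul, Matrix.det_mul, Matrix.det_transpose]; ring

/-- A determinant whose `i`-th row consists of homogeneous polynomials of degree `k i` is homogeneous of degree `∑ i, k i`. [folklore] -/
theorem isHomogeneous_det_of_rows {τ R : Type*} [CommRing R] {n : Type*} [Fintype n] [DecidableEq n] (M : Matrix n n (MvPolynomial τ R))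
    (k : n → ℕ) (h : ∀ i j, (M i j).IsHomogeneous (k i)) : M.det.IsHomogeneous (∑ i, k i) := by
  rw [Matrix.det_apply']; refine IsHomogeneous.sum _ _ _ fun σ _ => ?_
  have hp : (∏ i, M (σ i) i).IsHomogeneous (∑ i, k (σ i)) := IsHomogeneous.prod _ _ _ fun i _ => h _ _
  rw [Equiv.sum_comp σ k] at hp
  have hc : ((Equiv.Perm.sign σ : ℤ) : MvPolynomial τ R).IsHomogeneous 0 := by
    rw [← map_intCast (C : R →+* MvPolynomial τ R)]; exact isHomogeneous_C _ _
  simpa using hc.mul hp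

/-- Entries of a product of matrices with homogeneous entries are homogeneous, degrees adding. [folklore] -/
theorem isHomogeneous_mul_apply {τ R : Type*} [CommRing R] {n : Type*} [Fintype n] {A B : Matrix n n (MvPolynomial τ R)} {p q : ℕ}
    (hA : ∀ i j, (A i j).IsHomogeneous p) (hB : ∀ i j, (B i j).IsHomogeneous q) (i j : n) : ((A * B) i j).IsHomogeneous (p + q) := by
  rw [Matrix.mul_apply]; exact IsHomogeneous.sum _ _ _ fun l _ => (hA i l).mul (hB l j)

/-- The adjugate of a `3 × 3` matrix of variables has homogeneous quadratic entries. [folklore] -/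
theorem isHomogeneous_adjugate_X {τ R : Type*} [CommRing R] (v : Fin 3 → Fin 3 → τ) (i j : Fin 3) :
    ((Matrix.of fun a b => (X (v a b) : MvPolynomial τ R)).adjugate i j).IsHomogeneous 2 := by
  rw [Matrix.adjugate_apply]
  have hk : (∑ r : Fin 3, if r = j then 0 else 1) = 2 := by fin_cases j <;> simp [Fin.sum_univ_three]
  have h := isHomogeneous_det_of_rows ((Matrix.of fun a b => (X (v a b) : MvPolynomial τ R)).updateRow j (Pi.single i 1))
    (fun r => if r = j then 0 else 1) fun r c => by
      rw [Matrix.updateRow_apply]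
      by_cases hr : r = j
      · simp only [hr, if_true, Pi.single_apply]
        by_cases hc : c = i
        · simp only [hc, if_true]; exact isHomogeneous_one _ _
        · simp only [hc, if_false]; exact isHomogeneous_zero _ _ _
      · simp only [hr, if_false, Matrix.of_apply]; exact isHomogeneous_X _ _
  rwa [hk] at h

/-- **Strassen's form is homogeneous of degree `12`** when the slices have linear entries and the protected slice is a matrix of variables. [folklore] -/
theorem isHomogeneous_strassenForm {τ R : Type*} [CommRing R] {Y₀ Y₁ Y₂ : Matrix (Fin 3) (Fin 3) (MvPolynomial τ R)} (v : Fin 3 → Fin 3 → τ)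
    (h₂ : Y₂ = Matrix.of fun a b => X (v a b)) (h₀ : ∀ i j, (Y₀ i j).IsHomogeneous 1) (h₁ : ∀ i j, (Y₁ i j).IsHomogeneous 1) :
    (Y₀ * Y₂.adjugate * Y₁ - Y₁ * Y₂.adjugate * Y₀).det.IsHomogeneous 12 := by
  subst h₂; have h4 : ∀ i j, ((Y₀ * (Matrix.of fun a b => (X (v a b) : MvPolynomial τ R)).adjugate * Y₁ -
      Y₁ * (Matrix.of fun a b => (X (v a b) : MvPolynomial τ R)).adjugate * Y₀) i j).IsHomogeneous 4 := fun i j => by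
    rw [Matrix.sub_apply]
    exact (isHomogeneous_mul_apply (isHomogeneous_mul_apply h₀ (isHomogeneous_adjugate_X v)) h₁ i j).sub
      (isHomogeneous_mul_apply (isHomogeneous_mul_apply h₁ (isHomogeneous_adjugate_X v)) h₀ i j)
  simpa using isHomogeneous_det_of_rows _ (fun _ => 4) h4

/-! ## §1  The dimension bound `dim HWV_Λ(ℂ[V]_d) ≤ g(λ¹, λ², λ³)` and the one-dimensional case -/

/-- The symmetric array is additive: `arrOf (p + q) = arrOf p + arrOf q`. [bookkeeping] -/
theorem arrOf_add {m d : ℕ} (p q : MvPolynomial (Idx m) ℂ) (J : Fin d → Idx m) : arrOf d (p + q) J = arrOf d p J + arrOf d q J := by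
  classical
  simp only [arrOf, MvPolynomial.coeff_add, add_div]

/-- **Highest weight vectors are counted by the Kronecker coefficient**: for a type `λ = (λ¹, λ², λ³) ⊢ d` with at most `m` rows per factor,
`dim HWV_Λ(ℂ[ℂᵐ ⊗ ℂᵐ ⊗ ℂᵐ]_d) ≤ g(λ¹, λ², λ³)` (`Λ` the reversed exponents): the symmetric array `F ↦ arrOf F` on reversed letters (`arrOf_rev_mem_tripleHw`)
embeds `HWV_Λ` linearly (injective by `sum_arrOf_mul_prod_X`) into the `S_d`-invariants of the triple highest-weight slice of `((ℂᵐ)^{⊗d})^{⊗3}`, of dimension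
`g` (`finrank_invariants_tripleHwRep`).  (Schur–Weyl duality gives equality; only `≤` is needed.) [cite: BurgisserIkenmeyer2011, §3.1, Lemma 3.2] [cite: IkenmeyerPanova2017, §1.1] -/
theorem finrank_hwvSpace_le_kroneckerCoeff {m d : ℕ} (lam : Fin 3 → Nat.Partition d) (Λ : Fin 3 → Fin m → ℕ)
    (hΛ : ∀ (s : Fin 3) (i : Fin m), Λ s (Fin.rev i) = (lam s).sortedParts.getD i 0) (hcard : ∀ s, (lam s).parts.card ≤ m) :
    Module.finrank ℂ (hwvSpace Λ d) ≤ kroneckerCoeff ℂ (lam 0) (lam 1) (lam 2) := by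
  classical
  set V := tripleHw ℂ m d (Weight.ofPartition m (lam 0)) (Weight.ofPartition m (lam 1)) (Weight.ofPartition m (lam 2)) with hV
  set ρ := tripleHwRep ℂ m d (Weight.ofPartition m (lam 0)) (Weight.ofPartition m (lam 1)) (Weight.ofPartition m (lam 2)) with hρ
  let arr : MvPolynomial (Idx m) ℂ → Word3 m d → ℂ := fun F x => arrOf d F (fun r => (Fin.rev (x.1.1 r), Fin.rev (x.1.2 r), Fin.rev (x.2 r)))
  have harr_mem : ∀ F : hwvSpace Λ d, arr F ∈ V := fun F => arrOf_rev_mem_tripleHw lam Λ hΛ F.2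
  have hinv : ∀ F : hwvSpace Λ d, (⟨arr F, harr_mem F⟩ : V) ∈ ρ.invariants := fun F => by
    rw [Representation.mem_invariants]; intro τ; apply Subtype.ext; funext x; rw [coe_tripleHwRep_apply]
    exact arrOf_comp_perm (F : MvPolynomial (Idx m) ℂ) (fun r => (Fin.rev (x.1.1 r), Fin.rev (x.1.2 r), Fin.rev (x.2 r))) τ
  let f : hwvSpace Λ d →ₗ[ℂ] ρ.invariants :=
    { toFun := fun F => ⟨⟨arr F, harr_mem F⟩, hinv F⟩
      map_add' := fun F G => by apply Subtype.ext; apply Subtype.ext; funext x; exact arrOf_add _ _ _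
      map_smul' := fun c F => by apply Subtype.ext; apply Subtype.ext; funext x; exact arrOf_smul _ _ _ }
  have hf : Function.Injective f := by
    intro F G hFG
    have h : arr F = arr G := congrArg (fun y : ρ.invariants => ((y : V) : Word3 m d → ℂ)) hFG
    apply Subtype.ext; rw [← sum_arrOf_mul_prod_X F.2.1, ← sum_arrOf_mul_prod_X G.2.1]
    refine Finset.sum_congr rfl fun J _ => ?_
    have hJ := congrFun h ((fun r => Fin.rev (J r).1, fun r => Fin.rev (J r).2.1), fun r => Fin.rev (J r).2.2)
    simp only [arr, Fin.rev_rev, Prod.mk.eta] at hJ; rw [hJ]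
  calc Module.finrank ℂ (hwvSpace Λ d) ≤ Module.finrank ℂ ρ.invariants := LinearMap.finrank_le_finrank_of_injective hf
    _ = kroneckerCoeff ℂ (lam 0) (lam 1) (lam 2) := finrank_invariants_tripleHwRep _ _ _ (hcard 0) (hcard 1) (hcard 2)

/-- Highest weight vectors of degree `d` form a finite-dimensional space (inside the forms of degree `d`). [bookkeeping] -/
theorem hwvSpace_finite {m : ℕ} (Λ : Fin 3 → Fin m → ℕ) (d : ℕ) : Module.Finite ℂ (hwvSpace Λ d) := by
  have hle : hwvSpace Λ d ≤ MvPolynomial.homogeneousSubmodule (Idx m) ℂ d := fun f hf => (mem_homogeneousSubmodule d f).2 hf.1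
  haveI : Module.Finite ℂ (homogeneousSubmodule (Idx m) ℂ d) := Module.Finite.iff_fg.mpr (homogeneousSubmodule_fg (Idx m) ℂ d)
  exact Module.Finite.of_injective (Submodule.inclusion hle) (Submodule.inclusion_injective hle)

/-- **One-dimensional types are decided by one vector**: if `dim HWV_Λ ≤ 1` and some `0 ≠ f ∈ HWV_Λ` vanishes on `GL³·t`, all of `HWV_Λ` does. [folklore] -/
theorem hwvSpace_le_orbitVanishing_of_finrank_le_one {m d : ℕ} {Λ : Fin 3 → Fin m → ℕ} (hdim : Module.finrank ℂ (hwvSpace Λ d) ≤ 1)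
    {f : MvPolynomial (Idx m) ℂ} (hf : f ∈ hwvSpace Λ d) (hf0 : f ≠ 0) {t : Tensor ℂ m} (hv : f ∈ orbitVanishing t) :
    hwvSpace Λ d ≤ orbitVanishing t := by
  haveI := hwvSpace_finite Λ d; have hne : (⟨f, hf⟩ : hwvSpace Λ d) ≠ 0 := fun h => hf0 (congrArg Subtype.val h)
  have h1 : Module.finrank ℂ (hwvSpace Λ d) = 1 := le_antisymm hdim (Module.finrank_pos_iff_exists_ne_zero.2 ⟨_, hne⟩)
  intro g hg
  obtain ⟨c, hc⟩ := (finrank_eq_one_iff_of_nonzero' _ hne).1 h1 ⟨g, hg⟩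
  rw [show g = c • f by simpa using (congrArg Subtype.val hc).symm]; exact (orbitVanishing t).smul_mem c hv

/-! ## §2  Strassen's form on `ℂ⁴ ⊗ ℂ⁴ ⊗ ℂ⁴`: evaluation on corner slices, the Borel law, vanishing on `Mat₄³·⟨4⟩`, a non-zero value -/

/-- **Evaluation**: at `t`, Strassen's form in the corner variables `x_{(a+1)(b+1)(c+1)}` is Strassen's form of the corner slices of `t`. [bookkeeping] -/
theorem evalT_strassenForm (Xs : Fin 3 → Matrix (Fin 3) (Fin 3) (MvPolynomial (Idx 4) ℂ))
    (hXs : ∀ a b c : Fin 3, Xs a b c = X (Fin.succ a, Fin.succ b, Fin.succ c)) (t : Tensor ℂ 4) :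
    evalT t (Xs 0 * (Xs 2).adjugate * Xs 1 - Xs 1 * (Xs 2).adjugate * Xs 0).det =
      ((Matrix.of fun b c : Fin 3 => t (Fin.succ 0) b.succ c.succ) * (Matrix.of fun b c : Fin 3 => t (Fin.succ 2) b.succ c.succ).adjugate *
            (Matrix.of fun b c : Fin 3 => t (Fin.succ 1) b.succ c.succ) -
          (Matrix.of fun b c : Fin 3 => t (Fin.succ 1) b.succ c.succ) * (Matrix.of fun b c : Fin 3 => t (Fin.succ 2) b.succ c.succ).adjugate *
            (Matrix.of fun b c : Fin 3 => t (Fin.succ 0) b.succ c.succ)).det := by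
  have hM : ∀ a : Fin 3, ((evalT t : MvPolynomial (Idx 4) ℂ →ₐ[ℂ] ℂ) : MvPolynomial (Idx 4) ℂ →+* ℂ).mapMatrix (Xs a) =
      Matrix.of fun b c : Fin 3 => t (Fin.succ a) b.succ c.succ := fun a => by
    ext b c; rw [RingHom.mapMatrix_apply, Matrix.map_apply, hXs, Matrix.of_apply]; exact MvPolynomial.aeval_X _ _
  have h := strassenForm_map ((evalT t : MvPolynomial (Idx 4) ℂ →ₐ[ℂ] ℂ) : MvPolynomial (Idx 4) ℂ →+* ℂ) (Xs 0) (Xs 1) (Xs 2)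
  rwa [hM 0, hM 1, hM 2] at h

/-- **Corner slices of `(A,B,C)·t`** for `A, B, C` with vanishing first column below the diagonal: the corner slice `a` of `(A,B,C)·t` is
`∑_{a'} A_{(a+1)(a'+1)} · B̄ · Z_{a'}(t) · C̄ᵀ` (`B̄, C̄` the lower-right corners of `B, C`, `Z_{a'}(t)` the corner slices of `t`). [bookkeeping] -/
theorem corner_actTensor (A B C : Matrix (Fin 4) (Fin 4) ℂ) (t : Tensor ℂ 4) (hA : ∀ i : Fin 3, A i.succ 0 = 0) (hB : ∀ i : Fin 3, B i.succ 0 = 0)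
    (hC : ∀ i : Fin 3, C i.succ 0 = 0) (a : Fin 3) :
    (Matrix.of fun b c : Fin 3 => actTensor A B C t a.succ b.succ c.succ) = ∑ a' : Fin 3, A a.succ a'.succ •
      ((Matrix.of fun i j : Fin 3 => B i.succ j.succ) * (Matrix.of fun b c : Fin 3 => t a'.succ b.succ c.succ) * (Matrix.of fun i j : Fin 3 => C i.succ j.succ)ᵀ) := by
  ext b c; simp only [Matrix.of_apply, actTensor_apply, Matrix.sum_apply, Matrix.smul_apply, Matrix.mul_apply, Matrix.transpose_apply, Fin.sum_univ_succ,
    Fin.sum_univ_zero, smul_eq_mul, hA, hB, hC, zero_mul, mul_zero, add_zero, zero_add]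
  ring

/-- **The Borel law**: Strassen's form in the corner variables is a weight vector of (reversed) type `((6,3,3),(4,4,4),(4,4,4))`, i.e. of exponents
`(0,3,3,6), (0,4,4,4), (0,4,4,4)`, in degree `12`. [cite: Strassen1983] [cite: BurgisserIkenmeyer2011, §3.1] -/
theorem strassenForm_mem_hwvSpace (Xs : Fin 3 → Matrix (Fin 3) (Fin 3) (MvPolynomial (Idx 4) ℂ))
    (hXs : ∀ a b c : Fin 3, Xs a b c = X (Fin.succ a, Fin.succ b, Fin.succ c)) :
    (Xs 0 * (Xs 2).adjugate * Xs 1 - Xs 1 * (Xs 2).adjugate * Xs 0).det ∈ hwvSpace ![![0, 3, 3, 6], ![0, 4, 4, 4], ![0, 4, 4, 4]] 12 := by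
  refine ⟨isHomogeneous_strassenForm (fun b c => ((Fin.succ 2, Fin.succ b, Fin.succ c) : Idx 4)) (Matrix.ext fun b c => hXs 2 b c)
    (fun i j => by rw [hXs]; exact isHomogeneous_X _ _) (fun i j => by rw [hXs]; exact isHomogeneous_X _ _), fun A B C hA hB hC t => ?_⟩
  have hA0 : ∀ i : Fin 3, A i.succ 0 = 0 := fun i => hA.1 _ _ (Fin.succ_pos i)
  have hB0 : ∀ i : Fin 3, B i.succ 0 = 0 := fun i => hB.1 _ _ (Fin.succ_pos i)
  have hC0 : ∀ i : Fin 3, C i.succ 0 = 0 := fun i => hC.1 _ _ (Fin.succ_pos i)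
  have hA' : A (Fin.succ 1) (Fin.succ 0) = 0 ∧ A (Fin.succ 2) (Fin.succ 0) = 0 ∧ A (Fin.succ 2) (Fin.succ 1) = 0 :=
    ⟨hA.1 _ _ (by decide), hA.1 _ _ (by decide), hA.1 _ _ (by decide)⟩
  have hdet : ∀ M : Matrix (Fin 4) (Fin 4) ℂ, M ∈ borel 4 →
      (Matrix.of fun i j : Fin 3 => M i.succ j.succ).det = M (Fin.succ 0) (Fin.succ 0) * M (Fin.succ 1) (Fin.succ 1) * M (Fin.succ 2) (Fin.succ 2) := fun M hM => by
    rw [Matrix.det_of_upperTriangular, Fin.prod_univ_three]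
    · rfl
    · exact fun i j hij => hM.1 _ _ (Fin.succ_lt_succ_iff.2 hij)
  rw [evalT_strassenForm Xs hXs, evalT_strassenForm Xs hXs, corner_actTensor A B C t hA0 hB0 hC0 0, corner_actTensor A B C t hA0 hB0 hC0 1,
    corner_actTensor A B C t hA0 hB0 hC0 2]
  simp only [Fin.sum_univ_three, hA'.1, hA'.2.1, hA'.2.2, zero_smul, zero_add, add_zero]
  rw [strassenForm_mix, strassenForm_sandwich, hdet B hB, hdet C hC]
  simp only [weightChar, Fin.prod_univ_four, Matrix.cons_val_zero, Matrix.cons_val_one, Matrix.head_cons, Matrix.cons_val_two,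
    Matrix.tail_cons, Matrix.cons_val_three, pow_zero, one_mul, Fin.succ_zero_eq_one, Fin.succ_one_eq_two, show (Fin.succ (2 : Fin 3) : Fin 4) = 3 from rfl]
  ring

/-- **Strassen's form vanishes on `3 × 3 × 3` tensors of rank `≤ 4` with invertible protected slice** (BCS Thm. (19.12): `6 + rk(Y₀Y₂⁻¹Y₁ − Y₁Y₂⁻¹Y₀) ≤ 2R(t) ≤ 8`,
so the `3 × 3` matrix is singular; `adj Y₂ = det Y₂ · Y₂⁻¹`). [cite: BurgisserClausenShokrollahi1997, Thm. (19.12)] [cite: Strassen1983] -/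
theorem strassenForm_eq_zero_of_tensorRank_le_four (t : Fin 3 → Fin 3 → Fin 3 → ℂ) (ht : tensorRank t ≤ 4) (hU : IsUnit (Matrix.of (t 2)).det) :
    (Matrix.of (t 0) * (Matrix.of (t 2)).adjugate * Matrix.of (t 1) - Matrix.of (t 1) * (Matrix.of (t 2)).adjugate * Matrix.of (t 0)).det = 0 := by
  have h := Literature.Computability.AlgebraicComplexity.BCS1997_thm_19_12_rank t 2 0 1 hU; rw [Fintype.card_fin] at h
  have key : Matrix.of (t 0) * (Matrix.of (t 2)).adjugate * Matrix.of (t 1) - Matrix.of (t 1) * (Matrix.of (t 2)).adjugate * Matrix.of (t 0) =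
      (Matrix.of (t 2)).det • (Matrix.of (t 0) * (Matrix.of (t 2))⁻¹ * Matrix.of (t 1) - Matrix.of (t 1) * (Matrix.of (t 2))⁻¹ * Matrix.of (t 0)) := by
    rw [show (Matrix.of (t 2)).adjugate = (Matrix.of (t 2)).det • (Matrix.of (t 2))⁻¹ by
      rw [Matrix.nonsing_inv_apply _ hU, smul_smul, hU.mul_val_inv, one_smul], Matrix.mul_smul, Matrix.smul_mul, Matrix.mul_smul, Matrix.smul_mul, smul_sub]
  rw [key, Matrix.det_smul]; by_contra hne
  have hunit : IsUnit (Matrix.of (t 0) * (Matrix.of (t 2))⁻¹ * Matrix.of (t 1) - Matrix.of (t 1) * (Matrix.of (t 2))⁻¹ * Matrix.of (t 0)) :=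
    (Matrix.isUnit_iff_isUnit_det _).2 (isUnit_iff_ne_zero.2 fun h0 => hne (by rw [h0, mul_zero]))
  have := Matrix.rank_of_isUnit _ hunit; rw [Fintype.card_fin] at this; omega

/-- **Strassen's form vanishes on `Mat₄³·⟨4⟩`**: the corner `3 × 3 × 3` sub-tensor of `[A|B|C]` has rank `≤ 4`, so the form vanishes whenever the protected
corner slice is invertible, hence always, by density: `P · D ≡ 0` with `D ≠ 0` the generic protected-slice determinant (`D = 1` at `A = 𝟙𝟙ᵀ, B = C = 1`).
[cite: Strassen1983] [cite: BurgisserClausenShokrollahi1997, Thm. (19.12)] [cite: BurgisserIkenmeyer2011, §3.1] -/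
theorem evalT_fromCols_strassenForm (Xs : Fin 3 → Matrix (Fin 3) (Fin 3) (MvPolynomial (Idx 4) ℂ))
    (hXs : ∀ a b c : Fin 3, Xs a b c = X (Fin.succ a, Fin.succ b, Fin.succ c)) (A B C : Matrix (Fin 4) (Fin 4) ℂ) :
    evalT (fromCols A B C) (Xs 0 * (Xs 2).adjugate * Xs 1 - Xs 1 * (Xs 2).adjugate * Xs 0).det = 0 := by
  classical
  -- vanishing when the protected corner slice is invertible
  have hvan : ∀ A B C : Matrix (Fin 4) (Fin 4) ℂ, IsUnit (Matrix.of fun b c : Fin 3 => fromCols A B C (Fin.succ 2) b.succ c.succ).det →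
      evalT (fromCols A B C) (Xs 0 * (Xs 2).adjugate * Xs 1 - Xs 1 * (Xs 2).adjugate * Xs 0).det = 0 := fun A B C hU => by
    rw [evalT_strassenForm Xs hXs]
    have hr : tensorRank (fun a b c : Fin 3 => fromCols A B C a.succ b.succ c.succ) ≤ 4 :=
      tensorRank_le_of_eq_sum (fun l a => A a.succ l) (fun l b => B b.succ l) (fun l c => C c.succ l)
        (by funext a b c; simp [fromCols, Finset.sum_apply, triad_apply])
    exact strassenForm_eq_zero_of_tensorRank_le_four (fun a b c : Fin 3 => fromCols A B C a.succ b.succ c.succ) hr hU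
  set F : MvPolynomial (Idx 4) ℂ := (Xs 0 * (Xs 2).adjugate * Xs 1 - Xs 1 * (Xs 2).adjugate * Xs 0).det with hFdef
  set Q : Idx 4 → MvPolynomial (MIdx 4) ℂ := fun p => fromCols (genMat 0) (genMat 1) (genMat 2) p.1 p.2.1 p.2.2 with hQ
  set P : MvPolynomial (MIdx 4) ℂ := MvPolynomial.bind₁ Q F with hPdef
  set D : MvPolynomial (MIdx 4) ℂ := (Matrix.of fun b c : Fin 3 => fromCols (genMat (m := 4) 0) (genMat 1) (genMat 2) (Fin.succ 2) b.succ c.succ).det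
    with hD
  have hP : ∀ e : MIdx 4 → ℂ, MvPolynomial.aeval e P = evalT (fromCols (matOf e 0) (matOf e 1) (matOf e 2)) F := fun e => by
    have hfun : (fun p : Idx 4 => MvPolynomial.aeval e (Q p)) = fun p : Idx 4 => fromCols (matOf e 0) (matOf e 1) (matOf e 2) p.1 p.2.1 p.2.2 :=
      funext fun p => aeval_fromCols_genMat e p.1 p.2.1 p.2.2
    rw [hPdef, MvPolynomial.aeval_bind₁, hfun]; rfl
  have hDe : ∀ e : MIdx 4 → ℂ, MvPolynomial.aeval e D = (Matrix.of fun b c : Fin 3 => fromCols (matOf e 0) (matOf e 1) (matOf e 2) (Fin.succ 2) b.succ c.succ).det := by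
    intro e; rw [hD, AlgHom.map_det]; congr 1; ext b c
    simp only [AlgHom.mapMatrix_apply, Matrix.map_apply, Matrix.of_apply, aeval_fromCols_genMat]
  -- `P * D` vanishes everywhere, hence is the zero polynomial; `D ≠ 0`
  have hPD : P * D = 0 := by
    refine MvPolynomial.funext fun e => ?_; rw [map_zero, map_mul]; change MvPolynomial.aeval e P * MvPolynomial.aeval e D = 0
    by_cases hdet : MvPolynomial.aeval e D = 0
    · rw [hdet, mul_zero]
    · rw [hP, hvan _ _ _ (isUnit_iff_ne_zero.2 (by rwa [hDe] at hdet)), zero_mul]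
  have hD0 : D ≠ 0 := by
    intro hD0
    obtain ⟨e, he0, he1, he2⟩ := matOf_entries (m := 4) (Matrix.of fun _ _ => (1 : ℂ)) 1 1
    have h1 : (Matrix.of fun b c : Fin 3 => fromCols (Matrix.of fun _ _ : Fin 4 => (1 : ℂ)) 1 1 (Fin.succ 2) b.succ c.succ) = 1 := by
      ext b c
      fin_cases b <;> fin_cases c <;> simp [fromCols, Finset.sum_apply, triad_apply, Matrix.one_apply]
    exact zero_ne_one (by simpa only [hD0, map_zero, he0, he1, he2, h1, Matrix.det_one] using hDe e)
  have hP0 : P = 0 := (mul_eq_zero.1 hPD).resolve_right hD0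
  obtain ⟨e, he0, he1, he2⟩ := matOf_entries A B C
  simpa only [hP0, map_zero, he0, he1, he2] using (hP e).symm

/-- **A `3 × 3 × 3` tensor where Strassen's form does not vanish**: `s₀ = (diag(0,1,2), P_cyc, 1)`, `S(s₀) = det(DP − PD) = −2`. [folklore] -/
theorem evalT_padTensor_strassenForm (Xs : Fin 3 → Matrix (Fin 3) (Fin 3) (MvPolynomial (Idx 4) ℂ))
    (hXs : ∀ a b c : Fin 3, Xs a b c = X (Fin.succ a, Fin.succ b, Fin.succ c)) :
    evalT (padTensor Fin.succ (![![![(0 : ℂ), 0, 0], ![0, 1, 0], ![0, 0, 2]], ![![0, 0, 1], ![1, 0, 0], ![0, 1, 0]],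
        ![![1, 0, 0], ![0, 1, 0], ![0, 0, 1]]] : Fin 3 → Fin 3 → Fin 3 → ℂ)) (Xs 0 * (Xs 2).adjugate * Xs 1 - Xs 1 * (Xs 2).adjugate * Xs 0).det = -2 := by
  rw [evalT_strassenForm Xs hXs]
  simp only [ObstructionDescentSubformatObstruction.padTensor_apply_emb _ (Fin.succ_injective 3)]
  simp [Matrix.det_fin_three, Matrix.adjugate_fin_three, Matrix.mul_apply, Fin.sum_univ_three]
  norm_num

/-! ## §3  The type `λ_S = ((6,3,3),(4,4,4),(4,4,4)) ⊢ 12`: multiplicity one, obstruction against `⟨4⟩`, occurrence on three letters; `u(3) = 5` -/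

/-- The number of parts is the length of the sorted parts. [bookkeeping] -/
theorem card_parts_eq_length_sortedParts {n : ℕ} (μ : Nat.Partition n) : μ.parts.card = μ.sortedParts.length := by
  unfold Nat.Partition.sortedParts; rw [Multiset.length_sort]

set_option maxHeartbeats 100000000 in
set_option maxRecDepth 100000 in
/-- The class sum `Σ_C |C| χ^{(6,3,3)}(C) χ^{(4,4,4)}(C)² = 12!` over `S₁₂` (verified Murnaghan–Nakayama evaluator, kernel computation).
[cite: FultonHarrisGTM129, Exercise 4.51] -/
theorem kronSum_strassenType : kronSum 12 [6, 3, 3] [4, 4, 4] [4, 4, 4] = ((12).factorial : ℕ) := by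
  decide +kernel

/-- **`g((6,3,3),(4,4,4),(4,4,4)) = 1`.** [cite: FultonHarrisGTM129, Exercise 4.51] [cite: BurgisserIkenmeyer2011, §10.1] -/
theorem kroneckerCoeff_strassenType (lam : Fin 3 → Nat.Partition 12) (h0 : (lam 0).sortedParts = [6, 3, 3]) (h1 : (lam 1).sortedParts = [4, 4, 4])
    (h2 : (lam 2).sortedParts = [4, 4, 4]) : kroneckerCoeff ℂ (lam 0) (lam 1) (lam 2) = 1 := by
  have e := kroneckerCoeff_eq_kronSum_div (lam 0) (lam 1) (lam 2)
  rw [h0, h1, h2, kronSum_strassenType, Int.ediv_self (by exact_mod_cast Nat.factorial_ne_zero _)] at e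
  exact_mod_cast e

/-- The reversed exponent table of the type `λ_S` and the row bound `ℓ(λ^{(k)}) ≤ 4`. [bookkeeping] -/
theorem strassenType_exponents (lam : Fin 3 → Nat.Partition 12) (h0 : (lam 0).sortedParts = [6, 3, 3]) (h1 : (lam 1).sortedParts = [4, 4, 4])
    (h2 : (lam 2).sortedParts = [4, 4, 4]) :
    (∀ (s : Fin 3) (i : Fin 4), (![![0, 3, 3, 6], ![0, 4, 4, 4], ![0, 4, 4, 4]] : Fin 3 → Fin 4 → ℕ) s (Fin.rev i) = (lam s).sortedParts.getD i 0) ∧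
      ∀ s, (lam s).parts.card ≤ 4 := by
  refine ⟨fun s i => ?_, fun s => ?_⟩ <;> obtain rfl | rfl | rfl : s = 0 ∨ s = 1 ∨ s = 2 := by fin_cases s <;> simp
  · rw [h0]; fin_cases i <;> rfl
  · rw [h1]; fin_cases i <;> rfl
  · rw [h2]; fin_cases i <;> rfl
  · rw [card_parts_eq_length_sortedParts, h0]; decide
  · rw [card_parts_eq_length_sortedParts, h1]; decide
  · rw [card_parts_eq_length_sortedParts, h2]; decide

/-- **Strassen's equation is an obstruction against `⟨4⟩` in degree `12`**: the type `((6,3,3),(4,4,4),(4,4,4))` does not occur in `⟨4⟩^{⊗12}` — its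
highest-weight space in `ℂ[ℂ⁴ ⊗ ℂ⁴ ⊗ ℂ⁴]₁₂` has dimension `≤ g = 1` and contains Strassen's form, which vanishes on `σ₄ ⊇ GL₄³·⟨4⟩` and is non-zero.
[cite: Strassen1983] [cite: BurgisserIkenmeyer2011, §3.1, §10.1] [cite: BurgisserClausenShokrollahi1997, Thm. (19.12)] -/
theorem isotypicSum_strassenType_unitTensor_four_eq_zero (lam : Fin 3 → Nat.Partition 12) (h0 : (lam 0).sortedParts = [6, 3, 3])
    (h1 : (lam 1).sortedParts = [4, 4, 4]) (h2 : (lam 2).sortedParts = [4, 4, 4]) :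
    isotypicSum₁ (lam 0) (isotypicSum₂ (lam 1) (isotypicSum₃ (lam 2) (kroneckerPow (unitTensor ℂ 4) 12))) = 0 := by
  classical
  obtain ⟨hΛ', hcard⟩ := strassenType_exponents lam h0 h1 h2
  have hdim : Module.finrank ℂ (hwvSpace ![![0, 3, 3, 6], ![0, 4, 4, 4], ![0, 4, 4, 4]] 12) ≤ 1 := by
    have h := finrank_hwvSpace_le_kroneckerCoeff lam _ hΛ' hcard
    rwa [kroneckerCoeff_strassenType lam h0 h1 h2] at h
  set Xs : Fin 3 → Matrix (Fin 3) (Fin 3) (MvPolynomial (Idx 4) ℂ) := fun a => Matrix.of fun b c => X (Fin.succ a, Fin.succ b, Fin.succ c) with hXsdef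
  have hXs : ∀ a b c : Fin 3, Xs a b c = X (Fin.succ a, Fin.succ b, Fin.succ c) := fun _ _ _ => rfl
  have hF0 : (Xs 0 * (Xs 2).adjugate * Xs 1 - Xs 1 * (Xs 2).adjugate * Xs 0).det ≠ 0 := fun h => by
    have := evalT_padTensor_strassenForm Xs hXs; rw [h, map_zero] at this; norm_num at this
  rw [← hwvSpace_le_orbitVanishing_iff_isotypicSum_eq_zero (unitTensor ℂ 4) lam _ hΛ']
  refine hwvSpace_le_orbitVanishing_of_finrank_le_one hdim (strassenForm_mem_hwvSpace Xs hXs) hF0 fun A B C _ _ _ => ?_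
  rw [actTensor_unitTensor]; exact evalT_fromCols_strassenForm Xs hXs A B C

/-- **… and it occurs on three letters**: the type `((6,3,3),(4,4,4),(4,4,4))` occurs in `s₀^{⊗12}` for the `3 × 3 × 3` tensor `s₀ = (diag(0,1,2) | P_cyc | 1)`,
since Strassen's form takes the value `−2 ≠ 0` at (the padding of) `s₀`. [cite: BurgisserIkenmeyer2011, §3.1, Lemma 3.2] -/
theorem isotypicSum_strassenType_witness_ne_zero (lam : Fin 3 → Nat.Partition 12) (h0 : (lam 0).sortedParts = [6, 3, 3])
    (h1 : (lam 1).sortedParts = [4, 4, 4]) (h2 : (lam 2).sortedParts = [4, 4, 4]) :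
    isotypicSum₁ (lam 0) (isotypicSum₂ (lam 1) (isotypicSum₃ (lam 2) (kroneckerPow (![![![(0 : ℂ), 0, 0], ![0, 1, 0], ![0, 0, 2]],
      ![![0, 0, 1], ![1, 0, 0], ![0, 1, 0]], ![![1, 0, 0], ![0, 1, 0], ![0, 0, 1]]] : Fin 3 → Fin 3 → Fin 3 → ℂ) 12))) ≠ 0 := by
  classical
  obtain ⟨hΛ', -⟩ := strassenType_exponents lam h0 h1 h2
  set Xs : Fin 3 → Matrix (Fin 3) (Fin 3) (MvPolynomial (Idx 4) ℂ) := fun a => Matrix.of fun b c => X (Fin.succ a, Fin.succ b, Fin.succ c) with hXsdef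
  have hXs : ∀ a b c : Fin 3, Xs a b c = X (Fin.succ a, Fin.succ b, Fin.succ c) := fun _ _ _ => rfl
  rw [← isotypicSum_kroneckerPow_padTensor_ne_zero_iff (Fin.succ_injective 3) _ lam,
    ← not_hwvSpace_le_orbitVanishing_iff_isotypicSum_ne_zero (padTensor (Fin.succ : Fin 3 → Fin 4) _) lam _ hΛ']
  intro hle
  refine not_mem_orbitVanishing_of_evalT_ne_zero ?_ (hle (strassenForm_mem_hwvSpace Xs hXs))
  rw [evalT_padTensor_strassenForm Xs hXs]; norm_num

/-- **`¬UOCC(4, 3)`: universal occurrence fails for `⟨4⟩` on three letters** — the lower cell of row `N = 3` of the universal-occurrence ladder, by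
Strassen's degree-`12` obstruction of multiplicity one. [cite: Strassen1983] [cite: BurgisserIkenmeyer2011, §3.1, §10.1] -/
theorem not_uocc_four_three : ¬ (∀ {ι : Type} [Fintype ι], Fintype.card ι ≤ 3 → ∀ (s : ι → ι → ι → ℂ) (d : ℕ) (lam : Fin 3 → Nat.Partition d),
    isotypicSum₁ (lam 0) (isotypicSum₂ (lam 1) (isotypicSum₃ (lam 2) (kroneckerPow s d))) ≠ 0 →
    isotypicSum₁ (lam 0) (isotypicSum₂ (lam 1) (isotypicSum₃ (lam 2) (kroneckerPow (unitTensor ℂ 4) d))) ≠ 0) := by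
  intro h
  have hP : (⟨↑[6, 3, 3], by decide, by decide⟩ : Nat.Partition 12).sortedParts = [6, 3, 3] := by
    change Multiset.sort _ _ = _; rw [Multiset.coe_sort]; exact List.mergeSort_eq_self _ (by decide)
  have hR : (⟨↑[4, 4, 4], by decide, by decide⟩ : Nat.Partition 12).sortedParts = [4, 4, 4] := by
    change Multiset.sort _ _ = _; rw [Multiset.coe_sort]; exact List.mergeSort_eq_self _ (by decide)
  set lam : Fin 3 → Nat.Partition 12 := ![⟨↑[6, 3, 3], by decide, by decide⟩, ⟨↑[4, 4, 4], by decide, by decide⟩, ⟨↑[4, 4, 4], by decide, by decide⟩]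
  exact h (by simp) _ 12 lam (isotypicSum_strassenType_witness_ne_zero lam hP hR hR) (isotypicSum_strassenType_unitTensor_four_eq_zero lam hP hR hR)

/-- **Row `N = 3` of the universal-occurrence ladder is closed: `u(3) = 5`**, i.e. `UOCC(m, 3) ↔ 5 ≤ m` (the upper cell `UOCC(5, 3)` is
`uocc_five_three` — the generic rank `R_gen(3) = 5`; the lower cell is Strassen's obstruction). [cite: Strassen1983] [cite: Lickteig1985]
[cite: BurgisserIkenmeyer2011, §3.1] -/
theorem uocc_three_iff_five_le {m : ℕ} : (∀ {ι : Type} [Fintype ι], Fintype.card ι ≤ 3 →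
    ∀ (s : ι → ι → ι → ℂ) (d : ℕ) (lam : Fin 3 → Nat.Partition d), isotypicSum₁ (lam 0) (isotypicSum₂ (lam 1) (isotypicSum₃ (lam 2) (kroneckerPow s d))) ≠ 0 →
    isotypicSum₁ (lam 0) (isotypicSum₂ (lam 1) (isotypicSum₃ (lam 2) (kroneckerPow (unitTensor ℂ m) d))) ≠ 0) ↔ 5 ≤ m := by
  refine ⟨fun h => ?_, fun h5 => uocc_mono_format h5 uocc_five_three⟩
  by_contra hlt; exact not_uocc_four_three (uocc_mono_format (show m ≤ 4 by omega) h)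

end Summit.MatrixMultiplication.MatrixMultiplication.Theorems.ObstructionCalculus
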